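import Summits.CriticalPhenomena.SAWScalingLimit.Theorems.SAWLeftRightFKGFKGToTraversalBoundWitnessCfg
import Summits.CriticalPhenomena.SAWScalingLimit.Theorems.SAWLeftRightFKGFKGToTraversalBoundFreeCarrier
import HarnessLib

/-!
# Setup of one far-tip configuration (witness glue T1 of `stub_necklaceWitnessFarU`)

Crux `SAWLeftRightFKG.FKGToTraversalBound` (stmt-CriticalPhenomena-1878), line `slit-necklace`, registered stub
`witness_setup`.

For a far-tip configuration `cfg : FarTipCfg D` (vocabulary file …WitnessCfg) we produce the two finite sets every
later glue lemma speaks about: the FREE SET `F` of the first far tip `t₀ = γ τ` (sites joined to `t₀` by carrier walks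
avoiding the attached set `K = Sp ∪ Ext`) and the carrier COMPONENT `B` of `t₀`, with their twenty-odd elementary
properties: `t₀, t₁ ∈ F`, the whole middle `γ τ … γ τ'` lies in `F`, `F ⊆ B ⊆ Λ`, mesh points of `B` lie in the
domain, `F ∩ K = ∅`, `4`-connectivity of `F`, `B` and of their complements, the contact classifications, FACT A,
the attachment of `K` to the trace of `C`, and the two near-stub contacts `γ (τ - 1)`, `γ (τ' + 1)` of the tips.

Proof: index bookkeeping on the self-avoiding chord `γ` (interior indices of the piece are off the spine, indices of
the middle are off `Ext` by injectivity of `γ.getVert`), the presentation identity `hid` turns chord edges between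
non-defect sites into carrier edges, the attachment of `Ext` follows `γ` down to `a₀ ∈ Ka` or up to `b₀ ∈ Kb` and
then the attachment of the spine; everything else is `free_carrier` applied with `K` and with `∅`.
Folklore; no named fact is used.
-/

noncomputable section

open Set SimpleGraph
open Literature.Probability.LatticeModels
open Literature.Probability.RandomPlanarGeometry
open Summit.CriticalPhenomena.SAWScalingLimit.Theorems.FKGToTraversalBound.Negative (dom)

namespace Summit.CriticalPhenomena.SAWScalingLimit.Theorems.FKGToTraversalBound.SlitNecklace

namespace FarTipCfg

variable {D : DobrushinDomain} (cfg : FarTipCfg D)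

/-! ### The middle of the piece -/

/-- Consecutive vertices of the middle `γ τ … γ τ'` are joined by a CARRIER edge: the chord edge is a domain edge
between two interior vertices of the piece, which are off the spine, hence off the defect set (presentation
identity). [folklore] -/
theorem setup_adj_middle {m : ℕ} (hτm : cfg.τ ≤ m) (hm : m < cfg.τ') :
    cfg.G.Adj (cfg.γ.getVert (m + 1)) (cfg.γ.getVert m) := by
  have hidx := cfg.idx_facts
  have hadj := cfg.γ.adj_getVert_succ (i := m) (by omega)
  have hS : ∀ n, cfg.i < n → n < cfg.j → cfg.γ.getVert n ∉ cfg.S := fun n h1 h2 h =>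
    cfg.hft.1.2.2.2 n h1 h2 (Finset.mem_coe.2 (Finset.mem_union_right _ h))
  exact ((cfg.hid _ _).2 ⟨hadj, hS m (by omega) (by omega), hS (m + 1) (by omega) (by omega)⟩).symm

/-- **The middle is off `K` and free**: every vertex `γ m`, `τ ≤ m ≤ τ'`, is off the attached set `K` (off the
spine as an interior vertex of the piece, off the exterior by injectivity of the chord) and is joined to `t₀` by a
carrier walk along the middle, off `K`. [folklore] -/
theorem setup_middle : ∀ m, cfg.τ ≤ m → m ≤ cfg.τ' → cfg.γ.getVert m ∉ cfg.K ∧ cfg.γ.getVert m ∈ cfg.Fset := by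
  have hidx := cfg.idx_facts
  -- off `K`
  have hK : ∀ m, cfg.τ ≤ m → m ≤ cfg.τ' → cfg.γ.getVert m ∉ cfg.K := by
    intro m h1 h2
    rw [K_def, Finset.mem_union, not_or]
    refine ⟨fun h => cfg.hft.1.2.2.2 m (by omega) (by omega) (Finset.mem_coe.2 h), fun h => ?_⟩
    obtain ⟨m', hm', hor, he⟩ := cfg.mem_Ext_iff.1 h
    have := cfg.hγ.getVert_injOn (by simp only [Set.mem_setOf_eq]; omega)
      (by simp only [Set.mem_setOf_eq]; omega) he
    omega
  intro m
  induction m with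
  | zero =>
    -- vacuous: `τ > i ≥ 0`
    intro h0 _
    exact absurd h0 (by omega)
  | succ m ih =>
    intro h1 h2
    refine ⟨hK (m + 1) h1 h2, ?_⟩
    rcases Nat.lt_or_ge m cfg.τ with hlt | hge
    · -- `m + 1 = τ`: the trivial walk at `t₀`
      have hτ : cfg.τ = m + 1 := by omega
      have e : cfg.t₀ = cfg.γ.getVert (m + 1) := by rw [← hτ]; rfl
      refine cfg.mem_Fset_iff.2 ⟨(Walk.nil : cfg.G.Walk cfg.t₀ cfg.t₀).copy e rfl, ?_⟩
      intro v hv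
      rw [Walk.support_copy, Walk.support_nil, List.mem_singleton] at hv
      exact hv ▸ hK cfg.τ le_rfl (by omega)
    · -- one more carrier edge along the middle
      obtain ⟨q, hq⟩ := cfg.mem_Fset_iff.1 (ih hge (by omega)).2
      refine cfg.mem_Fset_iff.2 ⟨Walk.cons (cfg.setup_adj_middle hge (by omega)) q, fun v hv => ?_⟩
      rw [Walk.support_cons, List.mem_cons] at hv
      rcases hv with rfl | hv
      · exact hK (m + 1) h1 h2
      · exact hq v hv

/-! ### Attachment of `K` -/

/-- Following the chord DOWN from an index `m` to its start `a₀`: a lattice walk through vertices of index `≤ m`.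
[folklore] -/
theorem setup_prefix_walk : ∀ m, m ≤ cfg.γ.length →
    ∃ w : (zdGraph 2).Walk (cfg.γ.getVert m) cfg.a₀, ∀ z ∈ w.support, ∃ m', m' ≤ m ∧ cfg.γ.getVert m' = z := by
  have hle : cfg.Dg ≤ zdGraph 2 := (discreteDomainGraph_le_meshGraph _ _).trans (meshGraph_le_zdGraph _ _)
  intro m
  induction m with
  | zero =>
    intro _
    refine ⟨(Walk.nil : (zdGraph 2).Walk cfg.a₀ cfg.a₀).copy (cfg.γ.getVert_zero).symm rfl, fun z hz => ?_⟩
    rw [Walk.support_copy, Walk.support_nil, List.mem_singleton] at hz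
    exact ⟨0, le_rfl, by rw [hz, Walk.getVert_zero]⟩
  | succ m ih =>
    intro hm
    obtain ⟨w, hw⟩ := ih (by omega)
    have hadj : (zdGraph 2).Adj (cfg.γ.getVert (m + 1)) (cfg.γ.getVert m) :=
      (hle (cfg.γ.adj_getVert_succ (i := m) (by omega))).symm
    refine ⟨Walk.cons hadj w, fun z hz => ?_⟩
    rw [Walk.support_cons, List.mem_cons] at hz
    rcases hz with rfl | hz
    · exact ⟨m + 1, le_rfl, rfl⟩
    · obtain ⟨m', hm', rfl⟩ := hw z hz
      exact ⟨m', by omega, rfl⟩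

/-- Following the chord UP from an index `m` to its end `b₀`: a lattice walk through vertices of index in
`[m, |γ|]`. [folklore] -/
theorem setup_suffix_walk : ∀ d m, m + d = cfg.γ.length →
    ∃ w : (zdGraph 2).Walk (cfg.γ.getVert m) cfg.b₀, ∀ z ∈ w.support,
      ∃ m', m ≤ m' ∧ m' ≤ cfg.γ.length ∧ cfg.γ.getVert m' = z := by
  have hle : cfg.Dg ≤ zdGraph 2 := (discreteDomainGraph_le_meshGraph _ _).trans (meshGraph_le_zdGraph _ _)
  intro d
  induction d with
  | zero =>
    intro m hm
    rw [Nat.add_zero] at hm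
    refine ⟨(Walk.nil : (zdGraph 2).Walk cfg.b₀ cfg.b₀).copy (by rw [hm, Walk.getVert_length]) rfl,
      fun z hz => ?_⟩
    rw [Walk.support_copy, Walk.support_nil, List.mem_singleton] at hz
    exact ⟨m, le_rfl, hm.le, by rw [hz, hm, Walk.getVert_length]⟩
  | succ d ih =>
    intro m hm
    obtain ⟨w, hw⟩ := ih (m + 1) (by omega)
    have hadj : (zdGraph 2).Adj (cfg.γ.getVert m) (cfg.γ.getVert (m + 1)) :=
      hle (cfg.γ.adj_getVert_succ (i := m) (by omega))
    refine ⟨Walk.cons hadj w, fun z hz => ?_⟩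
    rw [Walk.support_cons, List.mem_cons] at hz
    rcases hz with rfl | hz
    · exact ⟨m, le_rfl, by omega, rfl⟩
    · obtain ⟨m', hm', hm'L, rfl⟩ := hw z hz
      exact ⟨m', by omega, hm'L, rfl⟩

/-- **`K` is attached to the trace of `C`**: spine sites by `hatt`; an exterior vertex `γ m` follows the chord down
to `a₀ ∈ Ka` (if `m < τ`) or up to `b₀ ∈ Kb` (if `m > τ'`) through exterior vertices, then the attachment of the
spine. [folklore] -/
theorem setup_K_attached : ∀ k ∈ cfg.K, ∃ (q : Site 2) (w : (zdGraph 2).Walk k q), q ∈ cfg.C.support ∧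
    ∀ z ∈ w.support, z ∈ cfg.K ∨ z ∈ cfg.C.support := by
  -- spine sites
  have hsp : ∀ k ∈ cfg.Sp, ∃ (q : Site 2) (w : (zdGraph 2).Walk k q), q ∈ cfg.C.support ∧
      ∀ z ∈ w.support, z ∈ cfg.K ∨ z ∈ cfg.C.support := by
    intro k hk
    obtain ⟨q, w, hq, hw⟩ := cfg.hatt k hk
    refine ⟨q, w, hq, fun z hz => ?_⟩
    rcases hw z hz with h | h
    · exact Or.inl (by rw [K_def]; exact Finset.mem_union_left _ h)
    · exact Or.inr h
  -- exterior vertices are in `K`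
  have hExt : ∀ m', m' ≤ cfg.γ.length → (m' < cfg.τ ∨ cfg.τ' < m') → cfg.γ.getVert m' ∈ cfg.K := fun m' h1 h2 => by
    rw [K_def]
    exact Finset.mem_union_right _ (cfg.mem_Ext_iff.2 ⟨m', h1, h2, rfl⟩)
  intro k hk
  rw [K_def, Finset.mem_union] at hk
  rcases hk with hk | hk
  · exact hsp k hk
  obtain ⟨m, hmL, hor, rfl⟩ := cfg.mem_Ext_iff.1 hk
  rcases hor with hmτ | hτ'm
  · -- down to `a₀`
    obtain ⟨w₁, hw₁⟩ := cfg.setup_prefix_walk m hmL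
    obtain ⟨q, w₂, hq, hw₂⟩ := hsp cfg.a₀ (by
      rw [PresCfg.Sp_def]
      exact Finset.mem_union_left _ (Finset.mem_union_left _ cfg.ha₀))
    refine ⟨q, w₁.append w₂, hq, fun z hz => ?_⟩
    rw [Walk.mem_support_append_iff] at hz
    rcases hz with hz | hz
    · obtain ⟨m', hm', rfl⟩ := hw₁ z hz
      exact Or.inl (hExt m' (by omega) (Or.inl (by omega)))
    · exact hw₂ z hz
  · -- up to `b₀`
    obtain ⟨w₁, hw₁⟩ := cfg.setup_suffix_walk (cfg.γ.length - m) m (by omega)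
    obtain ⟨q, w₂, hq, hw₂⟩ := hsp cfg.b₀ (by
      rw [PresCfg.Sp_def]
      exact Finset.mem_union_left _ (Finset.mem_union_right _ cfg.hb₀))
    refine ⟨q, w₁.append w₂, hq, fun z hz => ?_⟩
    rw [Walk.mem_support_append_iff] at hz
    rcases hz with hz | hz
    · obtain ⟨m', hm', hm'L, rfl⟩ := hw₁ z hz
      exact Or.inl (hExt m' hm'L (Or.inr (by omega)))
    · exact hw₂ z hz

/-! ### Mesh points of the carrier component -/

/-- The start of a carrier walk ending at a site whose mesh point is in the domain has its mesh point in the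
domain (its first edge is a domain edge by the presentation identity). [folklore] -/
theorem setup_meshPoint_mem_of_walk {x t : Site 2} (q : cfg.G.Walk x t) (ht : meshPoint cfg.δ t ∈ D.carrier) :
    meshPoint cfg.δ x ∈ D.carrier := by
  cases q with
  | nil => exact ht
  | cons h _ =>
    have hD := ((cfg.hid _ _).1 h).1
    exact (mem_meshVertices_iff.1
      (meshDomain_subset_meshVertices _ _ (discreteDomainGraph_adj_iff.1 hD).2.1))

end FarTipCfg

/-! ### The registered stub -/

/-- **Witness glue T1 — setup of a far-tip configuration.**  For a far-tip configuration `cfg` there are finite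
sets `F` (the free set of the first tip `t₀`: sites joined to `t₀` by carrier walks off `K`) and `B` (the carrier
component of `t₀`) with: the membership characterisations, `t₀, t₁ ∈ F`, `F ⊆ B ⊆ Λ`, mesh points of `B` in the
domain, the middle `γ τ … γ τ'` inside `F`, `F ∩ K = ∅`, `4`-connectivity of `F`, `B` and their complements, the
contact classifications, FACT A for `F` and `B`, the attachment of `K`, the near-stub contacts `γ (τ - 1)`,
`γ (τ' + 1)` (off `F`, lattice-adjacent to the tips) and `t₀ ≠ t₁`.  Composition of `free_carrier` (twice) with
index bookkeeping on the chord. [folklore] -/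
theorem witness_setup : ∀ {D : DobrushinDomain} (cfg : FarTipCfg D), ∃ F B : Finset (Site 2), (∀ x, x ∈ F ↔ x ∈ cfg.Fset) ∧ (∀ x, x ∈ B ↔ x ∈ cfg.Bset) ∧ cfg.t₀ ∈ F ∧ cfg.t₁ ∈ F ∧ F ⊆ B ∧ (∀ x ∈ B, x ∈ cfg.Λ) ∧ (∀ x ∈ B, meshPoint cfg.δ x ∈ D.carrier) ∧ (∀ m, cfg.τ ≤ m → m ≤ cfg.τ' → cfg.γ.getVert m ∈ F) ∧ (∀ x ∈ F, x ∉ cfg.K) ∧ (∀ x ∈ F, ∀ y ∈ F, ∃ p : (zdGraph 2).Walk x y, ∀ z ∈ p.support, z ∈ F) ∧ (∀ x y : Site 2, x ∉ F → y ∉ F → ∃ p : (zdGraph 2).Walk x y, ∀ z ∈ p.support, z ∉ F) ∧ (∀ x ∈ F, ∀ y : Site 2, y ∉ F → (zdGraph 2).Adj x y → y ∈ cfg.K ∨ y ∈ cfg.C.support) ∧ (∀ x ∈ F, ∀ y ∈ F, (zdGraph 2).Adj x y → cfg.G.Adj x y) ∧ (∀ x ∈ B, ∀ y ∈ B, ∃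 p : (zdGraph 2).Walk x y, ∀ z ∈ p.support, z ∈ B) ∧ (∀ x y : Site 2, x ∉ B → y ∉ B → ∃ p : (zdGraph 2).Walk x y, ∀ z ∈ p.support, z ∉ B) ∧ (∀ x ∈ B, ∀ y : Site 2, y ∉ B → (zdGraph 2).Adj x y → y ∈ cfg.C.support) ∧ (∀ x ∈ B, ∀ y ∈ B, (zdGraph 2).Adj x y → cfg.G.Adj x y) ∧ (∀ k ∈ cfg.K, ∃ (q : Site 2) (w : (zdGraph 2).Walk k q), q ∈ cfg.C.support ∧ ∀ z ∈ w.support, z ∈ cfg.K ∨ z ∈ cfg.C.support) ∧ cfg.γ.getVert (cfg.τ - 1) ∉ F ∧ cfg.γ.getVert (cfg.τ' + 1) ∉ F ∧ (zdGraph 2).Adj cfg.t₀ (cfg.γ.getVert (cfg.τ - 1)) ∧ (zdGraph 2).Adj cfg.t₁ (cfg.γ.getVert (cfg.τ' + 1)) ∧ cfg.t₀ ≠ cfg.t₁ := by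
  intro D cfg
  have hidx := cfg.idx_facts
  have hle : cfg.Dg ≤ zdGraph 2 := (discreteDomainGraph_le_meshGraph _ _).trans (meshGraph_le_zdGraph _ _)
  -- the first tip is off `K` and has a carrier edge into the middle
  have ht₀K : cfg.t₀ ∉ cfg.K := (cfg.setup_middle cfg.τ le_rfl (by omega)).1
  have hty : ∃ y, cfg.G.Adj cfg.t₀ y ∧ y ∉ cfg.K :=
    ⟨cfg.γ.getVert (cfg.τ + 1), (cfg.setup_adj_middle le_rfl cfg.hττ').symm,
      (cfg.setup_middle (cfg.τ + 1) (by omega) (by omega)).1⟩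
  -- the two applications of `free_carrier`
  obtain ⟨F, hFm, ht₀F, -, hFconn, hFcompl, hFcont, hFA⟩ :=
    free_carrier cfg.δ cfg.c cfg.C cfg.K cfg.t₀ cfg.hδ ht₀K cfg.setup_K_attached hty
  obtain ⟨y₁, hy₁, -⟩ := hty
  obtain ⟨B, hBm, -, hBΛ, hBconn, hBcompl, hBcont, hBA⟩ :=
    free_carrier cfg.δ cfg.c cfg.C ∅ cfg.t₀ cfg.hδ (Finset.notMem_empty _)
      (fun k hk => absurd hk (Finset.notMem_empty _)) ⟨y₁, hy₁, Finset.notMem_empty _⟩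
  -- membership characterisations
  have hF : ∀ x, x ∈ F ↔ x ∈ cfg.Fset := fun x => (hFm x).trans cfg.mem_Fset_iff.symm
  have hB : ∀ x, x ∈ B ↔ x ∈ cfg.Bset := fun x => by
    rw [hBm x, cfg.mem_Bset_iff]
    exact ⟨fun ⟨q, _⟩ => ⟨q⟩, fun ⟨q⟩ => ⟨q, fun v _ => Finset.notMem_empty v⟩⟩
  have hFK : ∀ x ∈ F, x ∉ cfg.K := fun x hx => by
    obtain ⟨q, hq⟩ := (hFm x).1 hx
    exact hq x q.start_mem_support
  -- the near-stub neighbours of the tips are exterior, hence in `K`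
  have hExt : ∀ m', m' ≤ cfg.γ.length → (m' < cfg.τ ∨ cfg.τ' < m') → cfg.γ.getVert m' ∈ cfg.K := fun m' h1 h2 => by
    rw [FarTipCfg.K_def]
    exact Finset.mem_union_right _ (cfg.mem_Ext_iff.2 ⟨m', h1, h2, rfl⟩)
  -- the chord edges at the tips
  have hpred : (zdGraph 2).Adj cfg.t₀ (cfg.γ.getVert (cfg.τ - 1)) := by
    have hadj := cfg.γ.adj_getVert_succ (i := cfg.τ - 1) (by omega)
    have e : cfg.τ - 1 + 1 = cfg.τ := by omega
    rw [e] at hadj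
    exact (hle hadj).symm
  have hsucc : (zdGraph 2).Adj cfg.t₁ (cfg.γ.getVert (cfg.τ' + 1)) :=
    hle (cfg.γ.adj_getVert_succ (i := cfg.τ') (by omega))
  -- the tips are distinct vertices of the self-avoiding chord
  have hne : cfg.t₀ ≠ cfg.t₁ := fun h => by
    have := cfg.hγ.getVert_injOn (by simp only [Set.mem_setOf_eq]; omega)
      (by simp only [Set.mem_setOf_eq]; omega) h
    omega
  refine ⟨F, B, hF, hB, ht₀F, ?_, ?_, hBΛ, ?_, ?_, hFK, hFconn, hFcompl, hFcont, hFA, hBconn, hBcompl, ?_, hBA,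
    cfg.setup_K_attached, ?_, ?_, hpred, hsucc, hne⟩
  · -- `t₁ ∈ F`
    exact (hF _).2 (cfg.setup_middle cfg.τ' cfg.hττ'.le le_rfl).2
  · -- `F ⊆ B`
    exact fun x hx => (hB x).2 (cfg.Fset_subset_Bset ((hF x).1 hx))
  · -- mesh points of `B` are in the domain
    intro x hx
    obtain ⟨q, -⟩ := (hBm x).1 hx
    have hadj := cfg.γ.adj_getVert_succ (i := cfg.τ) (by omega)
    exact cfg.setup_meshPoint_mem_of_walk q
      (mem_meshVertices_iff.1 (meshDomain_subset_meshVertices _ _ (discreteDomainGraph_adj_iff.1 hadj).2.1))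
  · -- the middle is in `F`
    exact fun m h1 h2 => (hF _).2 (cfg.setup_middle m h1 h2).2
  · -- contacts of `B`
    intro x hx y hy hxy
    rcases hBcont x hx y hy hxy with h | h
    · exact absurd h (Finset.notMem_empty _)
    · exact h
  · exact fun h => hFK _ h (hExt (cfg.τ - 1) (by omega) (Or.inl (by omega)))
  · exact fun h => hFK _ h (hExt (cfg.τ' + 1) (by omega) (Or.inr (by omega)))

end Summit.CriticalPhenomena.SAWScalingLimit.Theorems.FKGToTraversalBound.SlitNecklace

end
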